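import Summits.BirchSwinnertonDyer.BirchSwinnertonDyer.Theorems.ResidualThetaTransportAtTwoSignedMuSeedAtTwoPlusSplitFiniteness
import Summits.BirchSwinnertonDyer.BirchSwinnertonDyer.Theorems.ResidualThetaTransportAtTwoSignedMuVanishingAtTwoPlusSel2
import HarnessLib

/-!
# Seed crux `SignedMuSeedAtTwoPlus` (stmt-BirchSwinnertonDyer-21438), line `universal-norm-line`: stub 3
# `HalvesGiveSeed` VERBATIM — fine half ∧ plus-local half at every cyclotomic `κ` ⟹ `X⁺` torsion with `μ⁺ = 0`

Cell `bsd-wall`, width seat `bsd-wall-rtt-p4-w2` g9.  THEOREMS ONLY (no `def`, no named fact, no `sorry`); helper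
`--supports` the seed crux; BSD is NOT proved by this.  The line `universal-norm-line` (crux-ideate k1 g13,
`Cruxes/SignedMuSeedAtTwoPlus/Lines/universal_norm_line.lean`, unregistered per W-79) lists `stub_halvesGiveSeed : HalvesGiveSeed`
as «support, size S: `splitFiniteness` + the Sel2 door, by name».  This file is exactly that composition, with the line's
`FineMuZeroAtTwo` / `PlusLocalHalf` unfolded verbatim, so the stub closes by
`unfold HalvesGiveSeed FineMuZeroAtTwo PlusLocalHalf; exact Theorems.SignedMuAtTwo.halvesGiveSeed`:
`SignedMuAtTwo.FineSplit.splitFiniteness` (rtt-p4-w3, p596845: statement (A) + plus-local half ⟹ `Sel⁺(A/ℚ_∞)[2]` finite)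
followed by the SEL2 door `SignedMuAtTwo.isTorsion_and_mu_eq_zero_iff_finite_selmer_pTorsion` (p580570: finite `Sel⁺[2]` ⟺
`X⁺` torsion ∧ `μ⁺ = 0` for every finitely generated pinned plus dual).  [folklore]
-/

set_option autoImplicit false
set_option linter.dupNamespace false

noncomputable section

open WeierstrassCurve Literature.NumberTheory.EllipticCurves Literature.NumberTheory.EllipticCurves.IwasawaAlgebra
  Literature.NumberTheory.EllipticCurves.Kobayashi2003

namespace Summit.BirchSwinnertonDyer.BirchSwinnertonDyer.Theorems.SignedMuAtTwo

/-- **`HalvesGiveSeed` (stub 3 of line `universal-norm-line`, VERBATIM unfolded):** for `A/ℚ` elliptic, statement (A) at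
`(A, 2)` at every cyclotomic `κ` (some fine Selmer dual datum with `X₀` finitely generated over `ℤ₂`) together with the
plus-local half at every cyclotomic `κ` (finite image of `Sel⁺(A/ℚ_∞)[2]` in `H¹/Sel₀`) give, for every cyclotomic `κ`
with topological generator `γ` and every finitely generated pinned plus dual `D`: `X⁺ = D.X` is `Λ`-torsion with `μ = 0`.
BSD is not proved by this. [folklore] -/
theorem halvesGiveSeed :
    ∀ (A : WeierstrassCurve ℚ) [A.IsElliptic],
      (∀ (κ : ZpExtension ℚ 2), κ.IsCyclotomic →
        ∃ (γ : Field.absoluteGaloisGroup ℚ) (D : A.FineSelmerDualData κ γ),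
          Module.Finite ℤ_[2] (RestrictScalars ℤ_[2] (IwasawaAlgebra 2) D.X)) →
      (∀ (κ : ZpExtension ℚ 2), κ.IsCyclotomic →
        ((QuotientAddGroup.mk' (A.fineSelmerInfty κ)) ''
          {x : A.subgroupH1 2 κ.kerSubgroup | x ∈ signedSelmerInfty A κ 1 ∧ 2 • x = 0}).Finite) →
      ∀ (κ : ZpExtension ℚ 2) (γ : Field.absoluteGaloisGroup ℚ), κ.IsCyclotomic → κ.IsTopGenerator γ →
        ∀ (D : SignedSelmerDualData A κ γ 1) [Module.Finite (IwasawaAlgebra 2) D.X],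
          Module.IsTorsion (IwasawaAlgebra 2) D.X ∧ D.mu = 0 := by
  intro A _ hF hP κ γ hκ hγ D _
  exact (isTorsion_and_mu_eq_zero_iff_finite_selmer_pTorsion D).mpr
    (FineSplit.splitFiniteness A κ γ hκ hγ hF (hP κ hκ))

end Summit.BirchSwinnertonDyer.BirchSwinnertonDyer.Theorems.SignedMuAtTwo

end
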